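import Literature.RepresentationTheory.HeisenbergGroup.TateWeylPair
import Literature.NumberTheory.Automorphic.TateSelfDualHaar
import Literature.NumberTheory.Automorphic.SchwartzBruhatL2Dense
import Mathlib.Analysis.Normed.Operator.Extend
import Mathlib.MeasureTheory.Integral.Prod
import HarnessLib

/-!
# The `L²` Fourier transform of a non-archimedean local field (rank one): Plancherel and unitarity

Topic `NumberTheory/Automorphic`; namespace `Literature.NumberTheory.Automorphic`.  KERNEL ONLY: one definition
with body (`fourierL2`) and proved theorems; no named fact, no `sorry`, no instance.

Let `F` be a non-archimedean local field, `ψ : F → 𝕊` a continuous non-trivial additive character of conductor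
exponent `m` and `μ` an additive Haar measure on `F`.  Tate's Fourier transform `f̂(y) = ∫ f(x) ψ(xy) dμ(x)`
(`fourierSB ψ μ`, `TateLocalFactors`) preserves the Schwartz–Bruhat space `𝒮(F)` (`fourierSB_mem_schwartzBruhat`)
and satisfies the inversion formula with constant `(f̂)̂ = c · f(−·)`, `c = q^{-m} μ(𝒪)²`
(`TateSelfDualHaar.fourierSB_fourierSB_eq`; `c = 1` iff `μ` is self-dual, `isSelfDualMeasure_iff`).  This file is
the RANK-ONE companion of `LocalPiSchwartzBruhatPlancherel` (which treats `F^ι` with the measurable structure on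
`ι → F`) and adds the `L²` EXTENSION:

* §1 Fubini `∫ f̂ · G dμ = ∫_x f(x) ∫_y ψ(xy) G(y)` for `f, G ∈ 𝒮(F)` (`integral_fourierSB_mul`) and
  **PLANCHEREL** `∫ f̂ · conj f̂ dμ = c · ∫ f · conj f dμ` (`integral_fourierSB_mul_conj`), its `∫⁻ ‖·‖ₑ²` form
  (`lintegral_enorm_sq_fourierSB`) and the `L²`-norm form `‖[f̂]‖ = √c · ‖[f]‖` (`norm_toLp_fourierSB`)
  ([WeilBNT1967] Chap. VII §2, Cor. 1; [Tate1950] Thm 2.2.2: for the self-dual measure `f ↦ f̂` is `L²`-isometric);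
* §2 for a SELF-DUAL `μ`: **`fourierL2 μ hψ hμ : Lp ℂ 2 μ ≃ₗᵢ[ℂ] Lp ℂ 2 μ`**, the unique UNITARY extension of
  `f ↦ f̂` from the dense subspace `𝒮(F)` (`SchwartzBruhat.denseRange_toLp`; Mathlib `LinearEquiv.extendOfIsometry`
  applied to the tree's `HeisenbergGroup.tateWeylEquivSB`, Tate's Fourier transform as an automorphism of `𝒮(F)`),
  with `fourierL2_toLp` (`𝔽[f] = [f̂]` on Schwartz–Bruhat classes), uniqueness among continuous maps
  (`eq_fourierL2_of_apply_toLp`), and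
* §3 the **`L²` INVERSION FORMULA** `𝔽(𝔽 g) = g(−·)` for every `g ∈ L²(F, μ)` (`fourierL2_fourierL2`), where the
  reflection `g ↦ g(−·)` is Mathlib's `Lp.compMeasurePreservingₗᵢ` for `x ↦ −x` (measure preserving:
  `μ(−s) = ‖−1‖ μ(s) = μ(s)`, Tate's Lemma 2.2.5 `addHaar_smul_set`).

Use: the local Sonin spaces of Connes–Consani–Moscovici 2024, Def. 4.4 (`ConnesConsani2024/LocalSoninSpace.lean`),
are cut out of `L²(𝕂)` by `f = 0` and `𝔽f = 0` near `0`; for `𝕂` non-archimedean `𝔽` is this `fourierL2`.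

## References
* [Tate1950] J. Tate, *Fourier analysis in number fields and Hecke's zeta-functions* (1950), §2.2, Thm 2.2.2,
  Lemma 2.2.5.
* [WeilBNT1967] A. Weil, *Basic Number Theory* (1967), Chap. VII §2, Prop. 2, Cor. 1.
* [Weil1964] A. Weil, *Sur certains groupes d'opérateurs unitaires*, Acta Math. 111 (1964), Chap. I n° 11, n° 13
  (`Φ ↦ Φ*` is an automorphism of `𝒮` and unitary on `L²`).
-/

set_option autoImplicit false

noncomputable section

open _root_.MeasureTheory _root_.MeasureTheory.Measure Set Function _root_.Filter
open scoped ENNReal NNReal ComplexConjugate Topology Pointwise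

namespace Literature.NumberTheory.Automorphic

open Literature.NumberTheory.GaloisRepresentations.IsNonarchimedeanLocalField
open Literature.RepresentationTheory.HeisenbergGroup

variable {F : Type*} [Field F] [ValuativeRel F] [TopologicalSpace F] [IsNonarchimedeanLocalField F]
  [MeasurableSpace F] [BorelSpace F] (μ : Measure F) [μ.IsAddHaarMeasure] {ψ : AddChar F Circle} {m : ℤ}

/-! ## §0 Topological bookkeeping on `F` -/

omit [MeasurableSpace F] [BorelSpace F] in
/-- `F` is locally compact (a local field). [folklore] -/
private theorem locallyCompactSpace_F : LocallyCompactSpace F := (isLocalField F).toLocallyCompactSpace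

omit [MeasurableSpace F] [BorelSpace F] in
/-- `F` is Hausdorff. [folklore] -/
private theorem t2Space_F : T2Space F := (isLocalField F).toT2Space

omit [MeasurableSpace F] [BorelSpace F] in
/-- `F` is totally disconnected (its topology comes from a rank-one valuation, i.e. an ultrametric absolute
value); same argument as `GaloisRepresentations.totallyDisconnectedSpace_of_isNonarchimedeanLocalField`
(`LocalReciprocityThetaProofs`, not imported here to keep the import cone small). [folklore] -/
private theorem totallyDisconnectedSpace_F : TotallyDisconnectedSpace F := by
  letI := IsTopologicalAddGroup.rightUniformSpace F
  haveI := isUniformAddGroup_of_addCommGroup (G := F)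
  letI : (Valued.v (R := F)).RankOne :=
    { hom' := ValuativeRel.IsRankLeOne.nonempty.some.emb (R := F) |>.comp
        MonoidWithZeroHom.ValueGroup₀.embedding
      strictMono' := ValuativeRel.IsRankLeOne.nonempty.some.strictMono.comp
        MonoidWithZeroHom.ValueGroup₀.embedding_strictMono }
  letI := Valued.toNormedField F (ValuativeRel.ValueGroupWithZero F)
  infer_instance

/-- **`𝒮(F)` is dense in `L²(F, μ)`** for every Haar measure `μ` (the tree's `SchwartzBruhat.denseRange_toLp`,
its topological and regularity hypotheses discharged for a non-archimedean local field).
[cite: Weil1964, Chap. I n° 11] -/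
theorem denseRange_toLp_localField :
    DenseRange (SchwartzBruhat.toLp μ : SchwartzBruhat F → Lp ℂ 2 μ) := by
  haveI : SecondCountableTopology F := secondCountableTopology_localField F
  haveI := locallyCompactSpace_F (F := F)
  haveI := t2Space_F (F := F)
  haveI := totallyDisconnectedSpace_F (F := F)
  haveI : μ.Regular := regular_of_isAddHaarMeasure μ
  exact SchwartzBruhat.denseRange_toLp μ

/-! ## §1 Fubini and Plancherel for `𝒮(F)` -/

omit [μ.IsAddHaarMeasure] in
/-- the kernel `(y, x) ↦ ψ(xy) f(x) G(y)` is integrable on `F × F` for `f, G ∈ 𝒮(F)` (continuous with compact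
support; `μ` finite on compacts). [cite: WeilBNT1967, Chap. VII §2, Prop. 2] -/
theorem integrable_fourierKernel_rankOne [IsFiniteMeasureOnCompacts μ] (hψ : ψ.IsContinuousNontrivial)
    {f G : F → ℂ} (hf : f ∈ SchwartzBruhat F) (hG : G ∈ SchwartzBruhat F) :
    Integrable (uncurry fun (y x : F) => ((ψ (x * y) : Circle) : ℂ) * f x * G y) (μ.prod μ) := by
  haveI : SecondCountableTopology F := secondCountableTopology_localField F
  haveI := locallyCompactSpace_F (F := F)
  haveI := t2Space_F (F := F)
  haveI : ContinuousMul F := (isLocalField F).toIsTopologicalDivisionRing.toContinuousMul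
  have hcont : Continuous (uncurry fun (y x : F) => ((ψ (x * y) : Circle) : ℂ) * f x * G y) := by
    have h1 : Continuous fun p : F × F => ((ψ (p.2 * p.1) : Circle) : ℂ) :=
      continuous_subtype_val.comp (hψ.1.comp (continuous_snd.mul continuous_fst))
    exact (h1.mul (hf.1.continuous.comp continuous_snd)).mul (hG.1.continuous.comp continuous_fst)
  refine hcont.integrable_of_hasCompactSupport ?_
  refine HasCompactSupport.intro (hG.2.prod hf.2) ?_
  rintro ⟨y, x⟩ hp
  rw [Set.mem_prod, not_and_or] at hp
  simp only [uncurry_apply_pair]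
  rcases hp with hy | hx
  · rw [image_eq_zero_of_notMem_tsupport hy, mul_zero]
  · rw [image_eq_zero_of_notMem_tsupport hx, mul_zero, zero_mul]

omit [μ.IsAddHaarMeasure] in
/-- **Fubini for the Fourier transform against a Schwartz–Bruhat function**:
`∫ f̂(y) G(y) dμ(y) = ∫_x f(x) (∫_y ψ(xy) G(y) dμ(y)) dμ(x)` for `f, G ∈ 𝒮(F)`.
[cite: WeilBNT1967, Chap. VII §2, Prop. 2] -/
theorem integral_fourierSB_mul [IsFiniteMeasureOnCompacts μ] [SigmaFinite μ]
    (hψ : ψ.IsContinuousNontrivial) {f G : F → ℂ} (hf : f ∈ SchwartzBruhat F) (hG : G ∈ SchwartzBruhat F) :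
    ∫ y, fourierSB ψ μ f y * G y ∂μ = ∫ x, f x * ∫ y, ((ψ (x * y) : Circle) : ℂ) * G y ∂μ ∂μ := by
  have hswap := integral_integral_swap (integrable_fourierKernel_rankOne μ hψ hf hG)
  calc ∫ y, fourierSB ψ μ f y * G y ∂μ
      = ∫ y, ∫ x, ((ψ (x * y) : Circle) : ℂ) * f x * G y ∂μ ∂μ := by
        refine integral_congr_ae (Eventually.of_forall fun y => ?_)
        simp only [fourierSB_apply]
        rw [← integral_mul_const]
    _ = ∫ x, ∫ y, ((ψ (x * y) : Circle) : ℂ) * f x * G y ∂μ ∂μ := hswap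
    _ = ∫ x, f x * ∫ y, ((ψ (x * y) : Circle) : ℂ) * G y ∂μ ∂μ := by
        refine integral_congr_ae (Eventually.of_forall fun x => ?_)
        simp only
        rw [← integral_const_mul]
        refine integral_congr_ae (Eventually.of_forall fun y => ?_)
        simp only
        ring

omit [ValuativeRel F] [TopologicalSpace F] [IsNonarchimedeanLocalField F] [MeasurableSpace F] [BorelSpace F]
  [μ.IsAddHaarMeasure] in
/-- `conj ψ(t) = ψ(−t)` in `ℂ`. [folklore] -/
private theorem conj_coe_addChar (t : F) : conj ((ψ t : Circle) : ℂ) = ((ψ (-t) : Circle) : ℂ) := by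
  rw [AddChar.map_neg_eq_inv, Circle.coe_inv_eq_conj]

omit [ValuativeRel F] [TopologicalSpace F] [IsNonarchimedeanLocalField F] [BorelSpace F] [μ.IsAddHaarMeasure] in
/-- `∫_y ψ(xy) conj(G(y)) dμ = conj(Ĝ(−x))`. [cite: WeilBNT1967, Chap. VII §2, Prop. 2] -/
private theorem integral_addChar_mul_conj (x : F) (G : F → ℂ) :
    ∫ y, ((ψ (x * y) : Circle) : ℂ) * conj (G y) ∂μ = conj (fourierSB ψ μ G (-x)) := by
  rw [fourierSB_apply, ← integral_conj]
  refine integral_congr_ae (Eventually.of_forall fun y => ?_)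
  simp only [map_mul, conj_coe_addChar, mul_neg, neg_neg]
  rw [mul_comm y x]

omit [BorelSpace F] in
/-- `μ` is `σ`-finite (Haar measure on a second countable locally compact space), recorded for the Fubini step.
[folklore] -/
private theorem sigmaFinite_F : SigmaFinite μ := by
  haveI : SecondCountableTopology F := secondCountableTopology_localField F
  haveI := locallyCompactSpace_F (F := F)
  infer_instance

/-- **PLANCHEREL FOR `𝒮(F)`**: `∫ f̂ · conj f̂ dμ = c · ∫ f · conj f dμ` with `c = q^{-m} μ(𝒪)² = selfDualConst μ m`
the constant of Tate's inversion formula (`c = 1` for the self-dual measure).  Proof: Fubini against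
`G = conj f̂ ∈ 𝒮(F)`, `∫_y ψ(xy) conj f̂(y) = conj((f̂)̂(−x)) = c · conj f(x)` by inversion.
[cite: WeilBNT1967, Chap. VII §2, Cor. 1] [cite: Tate1950, Thm 2.2.2] -/
theorem integral_fourierSB_mul_conj (hψ : ψ.IsContinuousNontrivial) (hm : ψ.HasConductorExp m)
    {f : F → ℂ} (hf : f ∈ SchwartzBruhat F) :
    ∫ y, fourierSB ψ μ f y * conj (fourierSB ψ μ f y) ∂μ =
      (selfDualConst μ m : ℂ) * ∫ x, f x * conj (f x) ∂μ := by
  haveI := sigmaFinite_F μ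
  have hΨ : fourierSB ψ μ f ∈ SchwartzBruhat F := fourierSB_mem_schwartzBruhat μ hψ hf
  have hG : (fun y => conj (fourierSB ψ μ f y)) ∈ SchwartzBruhat F :=
    ⟨hΨ.1.comp _, hΨ.2.comp_left (map_zero _)⟩
  rw [integral_fourierSB_mul μ hψ hf hG, ← integral_const_mul]
  refine integral_congr_ae (Eventually.of_forall fun x => ?_)
  simp only
  rw [integral_addChar_mul_conj μ x, congr_fun (fourierSB_fourierSB_eq μ hψ.1 hm hf) (-x), neg_neg, map_mul,
    Complex.conj_ofReal]
  ring

omit [Field F] [ValuativeRel F] [IsNonarchimedeanLocalField F] [μ.IsAddHaarMeasure] in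
/-- `∫ f conj f dμ = ∫⁻ ‖f‖² dμ` (as a real number cast to `ℂ`) for `f ∈ 𝒮(F)`. [folklore] -/
private theorem integral_mul_conj_eq_lintegral [IsFiniteMeasureOnCompacts μ] {f : F → ℂ}
    (hf : f ∈ SchwartzBruhat F) :
    ∫ x, f x * conj (f x) ∂μ = ((∫⁻ x, ‖f x‖ₑ ^ 2 ∂μ).toReal : ℂ) := by
  have h1 : (fun x => f x * conj (f x)) = fun x => ((‖f x‖ ^ 2 : ℝ) : ℂ) := by
    funext x
    rw [Complex.mul_conj, Complex.normSq_eq_norm_sq]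
  rw [h1, integral_complex_ofReal]
  congr 1
  have hint : Integrable (fun x => ‖f x‖ ^ 2) μ := by
    refine Continuous.integrable_of_hasCompactSupport ((continuous_norm.comp hf.1.continuous).pow 2) ?_
    exact (hf.2.norm).comp_left (g := fun t : ℝ => t ^ 2) (zero_pow two_ne_zero)
  rw [integral_eq_lintegral_of_nonneg_ae (Eventually.of_forall fun x => sq_nonneg _)
    hint.aestronglyMeasurable]
  congr 1
  refine lintegral_congr fun x => ?_
  rw [← ofReal_norm, ENNReal.ofReal_pow (norm_nonneg _)]

omit [Field F] [ValuativeRel F] [IsNonarchimedeanLocalField F] [BorelSpace F] [μ.IsAddHaarMeasure] in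
/-- `∫⁻ ‖f‖² dμ < ∞` for `f ∈ 𝒮(F)`. [folklore] -/
private theorem sb_lintegral_enorm_sq_lt_top [IsFiniteMeasureOnCompacts μ] {f : F → ℂ}
    (hf : f ∈ SchwartzBruhat F) : ∫⁻ x, ‖f x‖ₑ ^ 2 ∂μ < ∞ :=
  SchwartzBruhat.l2NormSq_lt_top μ ⟨f, hf⟩

/-- **PLANCHEREL, `L²` form**: `∫⁻ ‖f̂‖² dμ = c · ∫⁻ ‖f‖² dμ`, `c = selfDualConst μ m`.
[cite: WeilBNT1967, Chap. VII §2, Cor. 1] [cite: Tate1950, Thm 2.2.2] -/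
theorem lintegral_enorm_sq_fourierSB (hψ : ψ.IsContinuousNontrivial) (hm : ψ.HasConductorExp m)
    {f : F → ℂ} (hf : f ∈ SchwartzBruhat F) :
    ∫⁻ y, ‖fourierSB ψ μ f y‖ₑ ^ 2 ∂μ = ENNReal.ofReal (selfDualConst μ m) * ∫⁻ x, ‖f x‖ₑ ^ 2 ∂μ := by
  have hΨ : fourierSB ψ μ f ∈ SchwartzBruhat F := fourierSB_mem_schwartzBruhat μ hψ hf
  have h := integral_fourierSB_mul_conj μ hψ hm hf
  rw [integral_mul_conj_eq_lintegral μ hΨ, integral_mul_conj_eq_lintegral μ hf, ← Complex.ofReal_mul,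
    Complex.ofReal_inj] at h
  have hc : 0 ≤ selfDualConst μ m := (selfDualConst_pos μ).le
  rw [← ENNReal.ofReal_toReal (sb_lintegral_enorm_sq_lt_top μ hΨ).ne,
    ← ENNReal.ofReal_toReal (sb_lintegral_enorm_sq_lt_top μ hf).ne, h, ENNReal.ofReal_mul hc]

/-- the Fourier transform of a Schwartz–Bruhat function, as a Schwartz–Bruhat function. [cite: Tate1950, §2.2] -/
def fourierSBMap (hψ : ψ.IsContinuousNontrivial) (Φ : SchwartzBruhat F) : SchwartzBruhat F :=
  ⟨fourierSB ψ μ Φ, fourierSB_mem_schwartzBruhat μ hψ Φ.2⟩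

/-- unfolding `fourierSBMap`. [cite: Tate1950, §2.2] -/
@[simp] theorem coe_fourierSBMap (hψ : ψ.IsContinuousNontrivial) (Φ : SchwartzBruhat F) :
    ((fourierSBMap μ hψ Φ : SchwartzBruhat F) : F → ℂ) = fourierSB ψ μ Φ := rfl

/-- **PLANCHEREL, norm form**: `‖[f̂]‖_{L²(μ)} = √c · ‖[f]‖_{L²(μ)}` for `f ∈ 𝒮(F)`, `c = selfDualConst μ m`.
[cite: WeilBNT1967, Chap. VII §2, Cor. 1] [cite: Tate1950, Thm 2.2.2] -/
theorem norm_toLp_fourierSB (hψ : ψ.IsContinuousNontrivial) (hm : ψ.HasConductorExp m)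
    (Φ : SchwartzBruhat F) :
    ‖SchwartzBruhat.toLp μ (fourierSBMap μ hψ Φ)‖ = Real.sqrt (selfDualConst μ m) * ‖SchwartzBruhat.toLp μ Φ‖ := by
  have hc : 0 ≤ selfDualConst μ m := (selfDualConst_pos μ).le
  have h1 : ‖SchwartzBruhat.toLp μ (fourierSBMap μ hψ Φ)‖ ^ 2 =
      selfDualConst μ m * ‖SchwartzBruhat.toLp μ Φ‖ ^ 2 := by
    rw [SchwartzBruhat.norm_toLp_sq, SchwartzBruhat.norm_toLp_sq, SchwartzBruhat.l2NormSq_def,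
      SchwartzBruhat.l2NormSq_def, coe_fourierSBMap, lintegral_enorm_sq_fourierSB μ hψ hm Φ.2,
      ENNReal.toReal_mul, ENNReal.toReal_ofReal hc]
  have h2 : ‖SchwartzBruhat.toLp μ (fourierSBMap μ hψ Φ)‖ =
      Real.sqrt (selfDualConst μ m * ‖SchwartzBruhat.toLp μ Φ‖ ^ 2) := by
    rw [← h1, Real.sqrt_sq (norm_nonneg _)]
  rw [h2, Real.sqrt_mul hc, Real.sqrt_sq (norm_nonneg _)]

/-- for a SELF-DUAL Haar measure the Fourier transform is `L²`-ISOMETRIC on `𝒮(F)`: `‖[f̂]‖ = ‖[f]‖`.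
[cite: Tate1950, Thm 2.2.2] [cite: Weil1964, Chap. I n° 11] -/
theorem norm_toLp_fourierSB_of_isSelfDualMeasure (hψ : ψ.IsContinuousNontrivial) (hμ : IsSelfDualMeasure ψ μ)
    (Φ : SchwartzBruhat F) :
    ‖SchwartzBruhat.toLp μ (fourierSBMap μ hψ Φ)‖ = ‖SchwartzBruhat.toLp μ Φ‖ := by
  obtain ⟨m, hm⟩ := hψ.exists_hasConductorExp
  rw [norm_toLp_fourierSB μ hψ hm, (isSelfDualMeasure_iff μ hψ.1 hm).1 hμ, Real.sqrt_one, one_mul]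

/-- the tree's `tateWeylEquivSB` (Fourier transform as a linear automorphism of `𝒮(F)`) is `fourierSBMap` on
elements. [cite: Tate1950, §2.2 Thm. 2.2.2] -/
theorem tateWeylEquivSB_apply_eq (hψ : ψ.IsContinuousNontrivial) (hμ : IsSelfDualMeasure ψ μ)
    (Φ : SchwartzBruhat F) : tateWeylEquivSB μ hψ hμ Φ = fourierSBMap μ hψ Φ :=
  Subtype.ext (coe_tateWeylEquivSB μ hψ hμ Φ)

/-! ## §2 The unitary Fourier transform `𝔽` of `L²(F, μ)` (self-dual `μ`) -/

/-- **the `L²` Fourier transform of a non-archimedean local field** for a continuous non-trivial character `ψ` and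
a SELF-DUAL Haar measure `μ`: the unique extension of `f ↦ f̂` (`fourierSB ψ μ`, an `L²`-isometric linear
automorphism of the dense subspace `𝒮(F)`) to a surjective linear isometry (unitary operator) of `L²(F, μ)`
(Mathlib `LinearEquiv.extendOfIsometry`). [cite: Tate1950, §2.2 Thm. 2.2.2] [cite: Weil1964, Chap. I n° 11] -/
def fourierL2 (hψ : ψ.IsContinuousNontrivial) (hμ : IsSelfDualMeasure ψ μ) : Lp ℂ 2 μ ≃ₗᵢ[ℂ] Lp ℂ 2 μ :=
  (tateWeylEquivSB μ hψ hμ).extendOfIsometry (SchwartzBruhat.toLp μ) (SchwartzBruhat.toLp μ)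
    (denseRange_toLp_localField μ) (denseRange_toLp_localField μ) fun Φ => by
      rw [tateWeylEquivSB_apply_eq μ hψ hμ Φ]
      exact norm_toLp_fourierSB_of_isSelfDualMeasure μ hψ hμ Φ

/-- **`𝔽[f] = [f̂]`** on Schwartz–Bruhat classes. [cite: Tate1950, §2.2 Thm. 2.2.2] -/
theorem fourierL2_toLp (hψ : ψ.IsContinuousNontrivial) (hμ : IsSelfDualMeasure ψ μ) (Φ : SchwartzBruhat F) :
    fourierL2 μ hψ hμ (SchwartzBruhat.toLp μ Φ) = SchwartzBruhat.toLp μ (fourierSBMap μ hψ Φ) := by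
  rw [fourierL2, LinearEquiv.extendOfIsometry_eq, tateWeylEquivSB_apply_eq]

/-- `𝔽[f] = f̂` almost everywhere, for `f ∈ 𝒮(F)`. [cite: Tate1950, §2.2 Thm. 2.2.2] -/
theorem coeFn_fourierL2_toLp (hψ : ψ.IsContinuousNontrivial) (hμ : IsSelfDualMeasure ψ μ)
    (Φ : SchwartzBruhat F) :
    (fourierL2 μ hψ hμ (SchwartzBruhat.toLp μ Φ) : F → ℂ) =ᵐ[μ] fourierSB ψ μ Φ := by
  rw [fourierL2_toLp]
  exact SchwartzBruhat.coeFn_toLp μ _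

/-- `𝔽⁻¹[f̂] = [f]` on Schwartz–Bruhat classes. [cite: Tate1950, §2.2 Thm. 2.2.2] -/
theorem fourierL2_symm_toLp (hψ : ψ.IsContinuousNontrivial) (hμ : IsSelfDualMeasure ψ μ)
    (Φ : SchwartzBruhat F) :
    (fourierL2 μ hψ hμ).symm (SchwartzBruhat.toLp μ (fourierSBMap μ hψ Φ)) = SchwartzBruhat.toLp μ Φ := by
  rw [← fourierL2_toLp μ hψ hμ Φ, LinearIsometryEquiv.symm_apply_apply]

/-- **uniqueness**: a CONTINUOUS self-map of `L²(F, μ)` that agrees with `[f] ↦ [f̂]` on Schwartz–Bruhat classes is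
`𝔽`. [cite: Weil1964, Chap. I n° 11] -/
theorem eq_fourierL2_of_apply_toLp (hψ : ψ.IsContinuousNontrivial) (hμ : IsSelfDualMeasure ψ μ)
    {T : Lp ℂ 2 μ → Lp ℂ 2 μ} (hT : Continuous T)
    (hTF : ∀ Φ : SchwartzBruhat F, T (SchwartzBruhat.toLp μ Φ) = SchwartzBruhat.toLp μ (fourierSBMap μ hψ Φ)) :
    T = fourierL2 μ hψ hμ := by
  funext f
  refine (denseRange_toLp_localField μ).induction_on f
    (isClosed_eq hT (fourierL2 μ hψ hμ).continuous) fun Φ => ?_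
  rw [hTF, fourierL2_toLp]

/-- `𝔽` preserves norms (unitarity). [cite: Weil1964, Chap. I n° 11] -/
theorem norm_fourierL2 (hψ : ψ.IsContinuousNontrivial) (hμ : IsSelfDualMeasure ψ μ) (f : Lp ℂ 2 μ) :
    ‖fourierL2 μ hψ hμ f‖ = ‖f‖ :=
  (fourierL2 μ hψ hμ).norm_map f

/-- `𝔽` preserves inner products (unitarity). [cite: Weil1964, Chap. I n° 11] -/
theorem inner_fourierL2 (hψ : ψ.IsContinuousNontrivial) (hμ : IsSelfDualMeasure ψ μ) (f g : Lp ℂ 2 μ) :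
    @inner ℂ _ _ (fourierL2 μ hψ hμ f) (fourierL2 μ hψ hμ g) = @inner ℂ _ _ f g :=
  (fourierL2 μ hψ hμ).inner_map_map f g

/-! ## §3 Reflection and the `L²` inversion formula `𝔽𝔽 g = g(−·)` -/

/-- **`x ↦ −x` preserves the Haar measure `μ`** (`μ(−s) = ‖−1‖_F μ(s) = μ(s)`, Tate's Lemma 2.2.5).
[cite: Tate1950, §2.2, Lemma 2.2.5] -/
theorem measurePreserving_neg : MeasurePreserving (fun x : F => -x) μ μ := by
  haveI : ContinuousNeg F := (isLocalField F).toIsTopologicalDivisionRing.toContinuousNeg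
  refine ⟨measurable_neg, ?_⟩
  ext s hs
  rw [Measure.map_apply measurable_neg hs]
  have h1 : (fun x : F => -x) ⁻¹' s = (-1 : F) • s := by
    ext x
    rw [Set.mem_preimage, Set.mem_smul_set_iff_inv_smul_mem₀ (by norm_num : (-1 : F) ≠ 0), inv_neg, inv_one,
      smul_eq_mul, neg_one_mul]
  rw [h1, addHaar_smul_set μ (by norm_num : (-1 : F) ≠ 0), normAbs_neg, map_one, ENNReal.coe_one, one_mul]

/-- **reflection** `g ↦ g(−·)` as a linear isometry of `L²(F, μ)` (Mathlib `Lp.compMeasurePreservingₗᵢ` for the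
measure-preserving map `x ↦ −x`); the operation `f ↦ f(−·)` of Tate's inversion formula on `L²` classes.
[cite: Tate1950, §2.2 Thm. 2.2.2] -/
def reflectL2 : Lp ℂ 2 μ →ₗᵢ[ℂ] Lp ℂ 2 μ :=
  Lp.compMeasurePreservingₗᵢ ℂ (fun x : F => -x) (measurePreserving_neg μ)

/-- `reflectL2 g = g ∘ (−·)` almost everywhere (the reflection `f(−x)` of Tate's inversion formula, on `L²`
classes). [cite: Tate1950, §2.2 Thm. 2.2.2] -/
theorem coeFn_reflectL2 (g : Lp ℂ 2 μ) : (reflectL2 μ g : F → ℂ) =ᵐ[μ] fun x => g (-x) :=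
  Lp.coeFn_compMeasurePreserving g (measurePreserving_neg μ)

/-- reflection of a Schwartz–Bruhat class: `[Φ](−·) = [Φ(−·)]` (the right-hand side `f(−x)` of Tate's inversion
formula, as an `L²` class). [cite: Tate1950, §2.2 Thm. 2.2.2] -/
theorem reflectL2_toLp (Φ : SchwartzBruhat F) (hΦ' : (fun x => (Φ : F → ℂ) (-x)) ∈ SchwartzBruhat F) :
    reflectL2 μ (SchwartzBruhat.toLp μ Φ) = SchwartzBruhat.toLp μ ⟨fun x => (Φ : F → ℂ) (-x), hΦ'⟩ := by
  refine Lp.ext_iff.2 ?_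
  refine (coeFn_reflectL2 μ _).trans ?_
  refine EventuallyEq.trans ?_ (SchwartzBruhat.coeFn_toLp μ _).symm
  have h := SchwartzBruhat.coeFn_toLp μ Φ
  exact (measurePreserving_neg μ).quasiMeasurePreserving.ae_eq_comp h

omit [MeasurableSpace F] [BorelSpace F] in
/-- `𝒮(F)` is stable under reflection `f ↦ f(−·)` (the right-hand side of Tate's inversion formula is again in
`𝒮(F)`). [cite: Tate1950, §2.2 Thm. 2.2.2] -/
theorem reflect_mem_schwartzBruhat {f : F → ℂ} (hf : f ∈ SchwartzBruhat F) :
    (fun x => f (-x)) ∈ SchwartzBruhat F := by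
  haveI : ContinuousNeg F := (isLocalField F).toIsTopologicalDivisionRing.toContinuousNeg
  refine ⟨hf.1.comp_continuous continuous_neg, ?_⟩
  exact hf.2.comp_homeomorph (Homeomorph.neg F)

/-- the reflection `g ↦ g(−·)` of `L²(F, μ)` is an involution. [cite: Tate1950, §2.2 Thm. 2.2.2] -/
theorem reflectL2_reflectL2 (g : Lp ℂ 2 μ) : reflectL2 μ (reflectL2 μ g) = g := by
  refine Lp.ext_iff.2 ?_
  refine (coeFn_reflectL2 μ _).trans ?_
  have h := coeFn_reflectL2 μ g
  have h2 : (fun x => (reflectL2 μ g : F → ℂ) (-x)) =ᵐ[μ] fun x => (fun y => (g : F → ℂ) (-y)) (-x) :=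
    (measurePreserving_neg μ).quasiMeasurePreserving.ae_eq_comp h
  refine h2.trans (Eventually.of_forall fun x => ?_)
  simp only [neg_neg]

/-- **`L²` INVERSION FORMULA**: `𝔽(𝔽 g) = g(−·)` for every `g ∈ L²(F, μ)` (`μ` self-dual) — by density from
Tate's `(f̂)̂ = f(−·)` on `𝒮(F)` (`IsSelfDualMeasure`), both sides being continuous in `g`.
[cite: Tate1950, §2.2 Thm. 2.2.2] -/
theorem fourierL2_fourierL2 (hψ : ψ.IsContinuousNontrivial) (hμ : IsSelfDualMeasure ψ μ) (g : Lp ℂ 2 μ) :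
    fourierL2 μ hψ hμ (fourierL2 μ hψ hμ g) = reflectL2 μ g := by
  have hcont1 : Continuous fun g : Lp ℂ 2 μ => fourierL2 μ hψ hμ (fourierL2 μ hψ hμ g) :=
    (fourierL2 μ hψ hμ).continuous.comp (fourierL2 μ hψ hμ).continuous
  refine (denseRange_toLp_localField μ).induction_on g
    (isClosed_eq hcont1 (reflectL2 μ).continuous) fun Φ => ?_
  rw [fourierL2_toLp, fourierL2_toLp,
    reflectL2_toLp μ Φ (reflect_mem_schwartzBruhat Φ.2)]
  congr 1
  exact Subtype.ext (hμ _ Φ.2)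

/-- `𝔽⁻¹ = reflection ∘ 𝔽`: `𝔽.symm g = (𝔽 g)(−·)`. [cite: Tate1950, §2.2 Thm. 2.2.2] -/
theorem fourierL2_symm_eq (hψ : ψ.IsContinuousNontrivial) (hμ : IsSelfDualMeasure ψ μ) (g : Lp ℂ 2 μ) :
    (fourierL2 μ hψ hμ).symm g = reflectL2 μ (fourierL2 μ hψ hμ g) := by
  have h := fourierL2_fourierL2 μ hψ hμ ((fourierL2 μ hψ hμ).symm g)
  rw [LinearIsometryEquiv.apply_symm_apply] at h
  rw [h, reflectL2_reflectL2]

end Literature.NumberTheory.Automorphic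

end
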